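import Literature.Probability.Distributions.GaussianTailBounds
import Literature.Probability.Process.BrownianLILUpper
import HarnessLib

/-!
# `limsup_n ξ_n/√(2 log n) = 1` a.s. for i.i.d. standard Gaussians (Kallenberg 2021, Exercise 13.17)

Topic `Probability/Independence` (the tree's home of the Borel–Cantelli exercises, cf.
`IIDMaximaExercises.lean`: Durrett's Exercise 2.3.15, the exponential analogue
`limsup X_n/log n = 1`); namespace `Literature.Probability.Independence`.  THEOREMS ONLY:
everything is PROVED; no definition, no named fact.

O. Kallenberg, *Foundations of Modern Probability* (3rd ed., 2021), Chapter 13, Exercise 17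
(p. 286):

> **17.** Let `ξ₁, ξ₂, …` be i.i.d. `N(0, 1)`. Show that `limsup_n (2 log n)^{-1/2} ξ_n = 1` a.s.

FORMALIZATION.  `X : ℕ → Ω → ℝ` independent (`iIndepFun`) with `Measure.map (X n) μ =
gaussianReal 0 1` for every `n`; `log` is `Real.log` (`log 0 = log 1 = 0` and Lean's `x/0 = 0`, so
the ratios at `n ≤ 1` are `0`).  Engines: the normal tail bounds of Durrett's Theorem 1.2.6 (the
tree's `Durrett2019_thm_1_2_6_upper/_lower`, `gaussianReal_real_Ici_eq`), giving
`P{ξ ≥ x} ≤ e^{−x²/2}` (`x ≥ 1`, the tree's `gaussianReal_real_Ici_le_exp` of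
`Process/BrownianLILUpper.lean`) and `P{ξ ≥ x} ≥ e^{−x²/2}/(4x)` (`x ≥ 2`), and Mathlib's two
Borel–Cantelli lemmas (`measure_limsup_atTop_eq_zero`, `measure_limsup_eq_one`):
`Σ_n P{ξ_n ≥ (1+ε)√(2 log n)} ≤ Σ_n n^{−(1+ε)²} < ∞`, while
`P{ξ_n ≥ (1−ε)√(2 log n)} ≥ n^{−(1−ε)²}/(4√(2 log n)) ≥ 1/(4n)` eventually, a divergent series.

* §1 `exp_neg_sq_le_gaussianReal_real_Ici` (lower tail);
* §2 **`Kallenberg2021_exercise_13_17_eventually_le`** (a.s. eventually `ξ_n ≤ (1+ε)√(2 log n)`);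
* §3 **`Kallenberg2021_exercise_13_17_frequently_ge`** (a.s. `ξ_n ≥ (1−ε)√(2 log n)` i.o.);
* §4 **`Kallenberg2021_exercise_13_17`** (`limsup_n ξ_n/√(2 log n) = 1` a.s.).

## References

* O. Kallenberg, *Foundations of Modern Probability*, 3rd ed., Springer (2021), Chapter 13,
  Exercise 17 (p. 286). [Kallenberg2021]
* R. Durrett, *Probability: Theory and Examples*, 5th ed. (2019), Theorem 1.2.6 (normal tail
  bounds); Theorems 2.3.1, 2.3.7 (Borel–Cantelli lemmas). [Durrett2019]
-/

noncomputable section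

namespace Literature.Probability.Independence

open MeasureTheory ProbabilityTheory Filter Set
open scoped Topology ENNReal NNReal

open Literature.Probability.Distributions

variable {Ω : Type*} {mΩ : MeasurableSpace Ω} {μ : Measure Ω} {X : ℕ → Ω → ℝ}

/-! ## §1 Normal tail bounds in the form used -/

/-- `P{ξ ≥ x} ≥ e^{−x²/2}/(4x)` for `x ≥ 2` (Durrett's Theorem 1.2.6, lower bound:
`x^{−1} − x^{−3} ≥ (3/4)x^{−1}` and `(2π)^{−1/2} ≥ 1/3`). [cite: Durrett2019, §1.2 Theorem 1.2.6] -/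
theorem exp_neg_sq_le_gaussianReal_real_Ici {x : ℝ} (hx : 2 ≤ x) :
    x⁻¹ * Real.exp (-x ^ 2 / 2) / 4 ≤ (gaussianReal 0 1).real (Ici x) := by
  rw [gaussianReal_real_Ici_eq]
  have hx0 : 0 < x := by linarith
  have h1 := Durrett2019_thm_1_2_6_lower hx0
  have hexp : 0 < Real.exp (-x ^ 2 / 2) := Real.exp_pos _
  -- `(2π)^{-1/2} ≥ 1/3`
  have hpi : (1 : ℝ) / 3 ≤ (Real.sqrt (2 * Real.pi))⁻¹ := by
    rw [one_div]
    refine inv_anti₀ (Real.sqrt_pos.2 (by positivity)) ?_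
    rw [show (3 : ℝ) = Real.sqrt (3 ^ 2) by rw [Real.sqrt_sq (by norm_num)]]
    exact Real.sqrt_le_sqrt (by nlinarith [Real.pi_le_four])
  -- `x⁻¹ − x⁻¹³ ≥ (3/4) x⁻¹`
  have hxinv : x⁻¹ ≤ 1 / 2 := by rw [one_div]; exact inv_anti₀ two_pos hx
  have hxinv0 : 0 < x⁻¹ := inv_pos.2 hx0
  have h3 : x⁻¹ ^ 2 ≤ 1 / 4 := by nlinarith
  have h2 : 3 / 4 * x⁻¹ ≤ x⁻¹ - x⁻¹ ^ 3 := by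
    have e : x⁻¹ ^ 3 = x⁻¹ * x⁻¹ ^ 2 := by ring
    rw [e]
    nlinarith [mul_le_mul_of_nonneg_left h3 hxinv0.le]
  have hint : 0 ≤ ∫ y in Ioi x, Real.exp (-y ^ 2 / 2) :=
    setIntegral_nonneg measurableSet_Ioi fun y _ ↦ (Real.exp_pos _).le
  calc x⁻¹ * Real.exp (-x ^ 2 / 2) / 4 = 1 / 3 * (3 / 4 * x⁻¹ * Real.exp (-x ^ 2 / 2)) := by ring
    _ ≤ (Real.sqrt (2 * Real.pi))⁻¹ * ((x⁻¹ - x⁻¹ ^ 3) * Real.exp (-x ^ 2 / 2)) := by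
        refine mul_le_mul hpi ?_ (by positivity) (le_trans (by norm_num) hpi)
        exact mul_le_mul_of_nonneg_right h2 hexp.le
    _ ≤ (Real.sqrt (2 * Real.pi))⁻¹ * ∫ y in Ioi x, Real.exp (-y ^ 2 / 2) :=
        mul_le_mul_of_nonneg_left h1 (le_trans (by norm_num) hpi)

/-- `−(a√(2 log m))²/2 = −a² log m` for `m ≥ 1`. [folklore] -/
private theorem neg_sq_mul_sqrt_two_log_div_two (a : ℝ) {m : ℕ} (hm : 1 ≤ m) :
    -(a * Real.sqrt (2 * Real.log m)) ^ 2 / 2 = -(a ^ 2 * Real.log m) := by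
  have hlog : 0 ≤ Real.log m := Real.log_nonneg (by exact_mod_cast hm)
  rw [mul_pow, Real.sq_sqrt (by positivity)]
  ring

/-- `√(2 log m) ≥ 1` for `m ≥ 2`. [folklore] -/
private theorem one_le_sqrt_two_log {m : ℕ} (hm : 2 ≤ m) : 1 ≤ Real.sqrt (2 * Real.log m) := by
  rw [show (1 : ℝ) = Real.sqrt 1 by simp]
  refine Real.sqrt_le_sqrt ?_
  have h2 : Real.log 2 ≤ Real.log m := Real.log_le_log two_pos (by exact_mod_cast hm)
  linarith [Real.log_two_gt_d9]

/-- The probability of the level set through the Gaussian law. [cite: Kallenberg2021, Chapter 13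
Exercise 17] -/
theorem measure_le_eq_gaussianReal (hXm : ∀ n, Measurable (X n))
    (hlaw : ∀ n, μ.map (X n) = gaussianReal 0 1) (c : ℝ) (n : ℕ) :
    μ {ω | c ≤ X n ω} = (gaussianReal 0 1) (Ici c) := by
  rw [← hlaw n, Measure.map_apply (hXm n) measurableSet_Ici]
  rfl

/-- shifting an `eventually` back by `k`. [folklore] -/
private theorem eventually_atTop_of_add {P : ℕ → Prop} (k : ℕ) (h : ∀ᶠ n in atTop, P (n + k)) :
    ∀ᶠ n in atTop, P n := by
  obtain ⟨N, hN⟩ := eventually_atTop.1 h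
  refine eventually_atTop.2 ⟨N + k, fun n hn ↦ ?_⟩
  obtain ⟨j, rfl⟩ := Nat.exists_eq_add_of_le hn
  have := hN (N + j) (Nat.le_add_right _ _)
  rwa [Nat.add_right_comm] at this

/-! ## §2 Upper half: a.s. eventually `ξ_n ≤ (1+ε)√(2 log n)` -/

/-- **Exercise 13.17, upper half**: for `ε > 0`, almost surely `ξ_n ≤ (1+ε)√(2 log n)`
eventually (`P{ξ_n ≥ (1+ε)√(2 log n)} ≤ n^{−(1+ε)²}`, summable; first Borel–Cantelli lemma).
[cite: Kallenberg2021, Chapter 13 Exercise 17] -/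
theorem Kallenberg2021_exercise_13_17_eventually_le [IsProbabilityMeasure μ]
    (hXm : ∀ n, Measurable (X n)) (hlaw : ∀ n, μ.map (X n) = gaussianReal 0 1)
    {ε : ℝ} (hε : 0 < ε) :
    ∀ᵐ ω ∂μ, ∀ᶠ n : ℕ in atTop, X n ω ≤ (1 + ε) * Real.sqrt (2 * Real.log n) := by
  have hb : ∀ n : ℕ, μ {ω | (1 + ε) * Real.sqrt (2 * Real.log ((n + 2 : ℕ) : ℝ)) ≤ X (n + 2) ω} ≤
      ENNReal.ofReal (((n + 2 : ℕ) : ℝ) ^ (-(1 + ε) ^ 2)) := by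
    intro n
    have hm2 : 2 ≤ n + 2 := Nat.le_add_left 2 n
    have hm0 : (0 : ℝ) < ((n + 2 : ℕ) : ℝ) := by positivity
    have hx1 : 1 ≤ (1 + ε) * Real.sqrt (2 * Real.log ((n + 2 : ℕ) : ℝ)) := by
      have h1 := one_le_sqrt_two_log hm2
      nlinarith
    rw [measure_le_eq_gaussianReal hXm hlaw, ← ofReal_measureReal (measure_ne_top _ _)]
    refine ENNReal.ofReal_le_ofReal
      ((Literature.Probability.Process.gaussianReal_real_Ici_le_exp hx1).trans (le_of_eq ?_))
    rw [neg_sq_mul_sqrt_two_log_div_two _ (le_trans one_le_two hm2), Real.rpow_def_of_pos hm0]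
    congr 1
    ring
  have hsum : ∑' n : ℕ, μ {ω | (1 + ε) * Real.sqrt (2 * Real.log ((n + 2 : ℕ) : ℝ)) ≤
      X (n + 2) ω} ≠ ∞ := by
    have hs : Summable fun n : ℕ ↦ (((n + 2 : ℕ) : ℝ)) ^ (-(1 + ε) ^ 2) :=
      (summable_nat_add_iff 2).2 (Real.summable_nat_rpow.2 (by nlinarith))
    refine ne_top_of_le_ne_top ?_ (ENNReal.tsum_le_tsum hb)
    rw [← ENNReal.ofReal_tsum_of_nonneg (fun n ↦ by positivity) hs]
    exact ENNReal.ofReal_ne_top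
  filter_upwards [measure_eq_zero_iff_ae_notMem.1 (measure_limsup_atTop_eq_zero hsum)] with ω hω
  rw [Filter.mem_limsup_iff_frequently_mem, Filter.not_frequently] at hω
  exact eventually_atTop_of_add 2 (hω.mono fun n hn ↦ (not_le.1 hn).le)

/-! ## §3 Lower half: a.s. `ξ_n ≥ (1−ε)√(2 log n)` infinitely often -/

/-- `√(2 log n) ≤ n^δ` eventually, for `δ > 0`. [folklore] -/
private theorem eventually_sqrt_two_log_le_rpow {δ : ℝ} (hδ : 0 < δ) :
    ∀ᶠ n : ℕ in atTop, Real.sqrt (2 * Real.log n) ≤ (n : ℝ) ^ δ := by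
  have h1 : ∀ᶠ x : ℝ in atTop, ‖Real.log x‖ ≤ 1 / 2 * ‖x ^ (2 * δ)‖ :=
    (isLittleO_log_rpow_atTop (by positivity : 0 < 2 * δ)).bound (by norm_num)
  filter_upwards [tendsto_natCast_atTop_atTop.eventually h1, eventually_ge_atTop 1] with n hn hn1
  have hn0 : (0 : ℝ) ≤ n := Nat.cast_nonneg n
  rw [Real.norm_of_nonneg (Real.log_nonneg (by exact_mod_cast hn1)),
    Real.norm_of_nonneg (by positivity)] at hn
  have h2 : 2 * Real.log n ≤ ((n : ℝ) ^ δ) ^ 2 := by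
    rw [← Real.rpow_natCast, ← Real.rpow_mul hn0]
    push_cast
    rw [mul_comm δ 2]
    linarith
  calc Real.sqrt (2 * Real.log n) ≤ Real.sqrt (((n : ℝ) ^ δ) ^ 2) := Real.sqrt_le_sqrt h2
    _ = (n : ℝ) ^ δ := Real.sqrt_sq (by positivity)

/-- **Exercise 13.17, lower half**: for `0 < ε < 1`, almost surely `ξ_n ≥ (1−ε)√(2 log n)`
infinitely often (`P{ξ_n ≥ (1−ε)√(2 log n)} ≥ n^{−(1−ε)²}/(4√(2 log n)) ≥ 1/(4n)` eventually, a
divergent series; independence and the second Borel–Cantelli lemma). [cite: Kallenberg2021,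
Chapter 13 Exercise 17] -/
theorem Kallenberg2021_exercise_13_17_frequently_ge [IsProbabilityMeasure μ]
    (hXm : ∀ n, Measurable (X n)) (hind : iIndepFun X μ)
    (hlaw : ∀ n, μ.map (X n) = gaussianReal 0 1) {ε : ℝ} (hε : 0 < ε) (hε1 : ε < 1) :
    ∀ᵐ ω ∂μ, ∃ᶠ n : ℕ in atTop, (1 - ε) * Real.sqrt (2 * Real.log n) ≤ X n ω := by
  have hA : ∀ n : ℕ, MeasurableSet {ω | (1 - ε) * Real.sqrt (2 * Real.log n) ≤ X n ω} :=
    fun n ↦ measurableSet_le measurable_const (hXm n)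
  have hindep : iIndepSet (fun n : ℕ ↦ {ω | (1 - ε) * Real.sqrt (2 * Real.log n) ≤ X n ω}) μ :=
    (iIndepSet_iff_meas_biInter hA).2 fun s ↦
      hind.measure_inter_preimage_eq_mul s fun n _ ↦
        (measurableSet_Ici : MeasurableSet (Ici ((1 - ε) * Real.sqrt (2 * Real.log n))))
  -- the eventual lower bound `P(A_n) ≥ 1/(4n)`
  set δ : ℝ := 1 - (1 - ε) ^ 2 with hδ
  have hδ0 : 0 < δ := by rw [hδ]; nlinarith
  have hlev : Tendsto (fun n : ℕ ↦ (1 - ε) * Real.sqrt (2 * Real.log n)) atTop atTop := by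
    refine Tendsto.const_mul_atTop (by linarith) (Real.tendsto_sqrt_atTop.comp ?_)
    exact (Real.tendsto_log_atTop.comp tendsto_natCast_atTop_atTop).const_mul_atTop two_pos
  have hev : ∀ᶠ n : ℕ in atTop,
      1 / (4 * (n : ℝ)) ≤ μ.real {ω | (1 - ε) * Real.sqrt (2 * Real.log n) ≤ X n ω} := by
    filter_upwards [hlev.eventually_ge_atTop 2, eventually_sqrt_two_log_le_rpow hδ0,
      eventually_ge_atTop 2] with n hn2 hnδ hn
    have hn0 : (0 : ℝ) < n := by exact_mod_cast lt_of_lt_of_le two_pos hn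
    have hsq1 := one_le_sqrt_two_log hn
    rw [measureReal_def, measure_le_eq_gaussianReal hXm hlaw, ← measureReal_def]
    refine le_trans ?_ (exp_neg_sq_le_gaussianReal_real_Ici hn2)
    rw [neg_sq_mul_sqrt_two_log_div_two _ (le_trans one_le_two hn)]
    -- `x⁻¹ ≥ n^{-δ}` and `e^{-(1-ε)² log n} = n^{-(1-ε)²}`, product `= n⁻¹`
    have hx0 : 0 < (1 - ε) * Real.sqrt (2 * Real.log n) := by nlinarith
    have hxle : (1 - ε) * Real.sqrt (2 * Real.log n) ≤ (n : ℝ) ^ δ := by nlinarith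
    have hinv : ((n : ℝ) ^ δ)⁻¹ ≤ ((1 - ε) * Real.sqrt (2 * Real.log n))⁻¹ := inv_anti₀ hx0 hxle
    have hexp : Real.exp (-((1 - ε) ^ 2 * Real.log n)) = (n : ℝ) ^ (-(1 - ε) ^ 2) := by
      rw [Real.rpow_def_of_pos hn0]; congr 1; ring
    have hprod : ((n : ℝ) ^ δ)⁻¹ * (n : ℝ) ^ (-(1 - ε) ^ 2) = (n : ℝ)⁻¹ := by
      rw [← Real.rpow_neg hn0.le, ← Real.rpow_add hn0, hδ, ← Real.rpow_neg_one]
      congr 1; ring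
    calc 1 / (4 * (n : ℝ)) = ((n : ℝ) ^ δ)⁻¹ * (n : ℝ) ^ (-(1 - ε) ^ 2) / 4 := by
          rw [hprod]; ring
      _ ≤ ((1 - ε) * Real.sqrt (2 * Real.log n))⁻¹ * Real.exp (-((1 - ε) ^ 2 * Real.log n)) / 4 := by
          rw [hexp]; gcongr
  have htop : ∑' n : ℕ, μ {ω | (1 - ε) * Real.sqrt (2 * Real.log n) ≤ X n ω} = ∞ := by
    by_contra hne
    have hs : Summable fun n : ℕ ↦ μ.real {ω | (1 - ε) * Real.sqrt (2 * Real.log n) ≤ X n ω} :=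
      ENNReal.summable_toReal hne
    obtain ⟨N, hN⟩ := eventually_atTop.1 hev
    -- compare the shifted harmonic series with the shifted summable one
    have hsN := (summable_nat_add_iff N).2 hs
    have hharm : Summable fun n : ℕ ↦ 1 / (((n + N : ℕ) : ℝ)) := by
      have h4 : Summable fun n : ℕ ↦ 1 / (4 * (((n + N : ℕ) : ℝ))) :=
        hsN.of_nonneg_of_le (fun n ↦ by positivity) fun n ↦ hN (n + N) (Nat.le_add_left N n)
      simpa [div_eq_mul_inv, mul_comm, mul_left_comm, mul_assoc] using h4.mul_left 4
    exact Real.not_summable_one_div_natCast ((summable_nat_add_iff N).1 hharm)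
  have h1 := measure_limsup_eq_one hA hindep htop
  have hc : μ (limsup (fun n : ℕ ↦ {ω | (1 - ε) * Real.sqrt (2 * Real.log n) ≤ X n ω}) atTop)ᶜ =
      0 := (prob_compl_eq_zero_iff (MeasurableSet.measurableSet_limsup hA)).2 h1
  have hae : ∀ᵐ ω ∂μ, ω ∈ limsup (fun n : ℕ ↦ {ω | (1 - ε) * Real.sqrt (2 * Real.log n) ≤ X n ω})
      atTop := by
    rw [ae_iff]; exact hc
  filter_upwards [hae] with ω hω
  rwa [Filter.mem_limsup_iff_frequently_mem] at hω

/-! ## §4 Exercise 13.17 -/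

/-- **Kallenberg 2021, Chapter 13, Exercise 17.** "Let `ξ₁, ξ₂, …` be i.i.d. `N(0,1)`. Show that
`limsup_n (2 log n)^{−1/2} ξ_n = 1` a.s." [cite: Kallenberg2021, Chapter 13 Exercise 17] -/
theorem Kallenberg2021_exercise_13_17 [IsProbabilityMeasure μ] (hXm : ∀ n, Measurable (X n))
    (hind : iIndepFun X μ) (hlaw : ∀ n, μ.map (X n) = gaussianReal 0 1) :
    ∀ᵐ ω ∂μ, limsup (fun n : ℕ ↦ X n ω / Real.sqrt (2 * Real.log n)) atTop = 1 := by
  have hup : ∀ j : ℕ, ∀ᵐ ω ∂μ, ∀ᶠ n : ℕ in atTop,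
      X n ω ≤ (1 + 1 / ((j : ℝ) + 1)) * Real.sqrt (2 * Real.log n) := fun j ↦
    Kallenberg2021_exercise_13_17_eventually_le hXm hlaw (by positivity)
  have hlow : ∀ j : ℕ, ∀ᵐ ω ∂μ, ∃ᶠ n : ℕ in atTop,
      (1 - 1 / ((j : ℝ) + 2)) * Real.sqrt (2 * Real.log n) ≤ X n ω := fun j ↦
    Kallenberg2021_exercise_13_17_frequently_ge hXm hind hlaw (by positivity) (by
      rw [div_lt_one (by positivity)]; linarith)
  filter_upwards [ae_all_iff.2 hup, ae_all_iff.2 hlow] with ω hωup hωlow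
  have hb : ∀ᶠ n : ℕ in atTop, 0 < Real.sqrt (2 * Real.log n) := by
    filter_upwards [eventually_ge_atTop 2] with n hn
    exact lt_of_lt_of_le one_pos (one_le_sqrt_two_log hn)
  have hupr : ∀ j : ℕ, ∀ᶠ n : ℕ in atTop,
      X n ω / Real.sqrt (2 * Real.log n) ≤ 1 + 1 / ((j : ℝ) + 1) := by
    intro j
    filter_upwards [hωup j, hb] with n hn hbn
    rwa [div_le_iff₀ hbn]
  have hlowr : ∀ j : ℕ, ∃ᶠ n : ℕ in atTop,
      1 - 1 / ((j : ℝ) + 2) ≤ X n ω / Real.sqrt (2 * Real.log n) := by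
    intro j
    refine ((hωlow j).and_eventually hb).mono fun n ⟨hn, hbn⟩ ↦ ?_
    rwa [le_div_iff₀ hbn]
  have hbdd : IsBoundedUnder (· ≤ ·) atTop fun n : ℕ ↦ X n ω / Real.sqrt (2 * Real.log n) :=
    isBoundedUnder_of_eventually_le (hupr 0)
  have hcobdd : IsCoboundedUnder (· ≤ ·) atTop fun n : ℕ ↦ X n ω / Real.sqrt (2 * Real.log n) :=
    IsCoboundedUnder.of_frequently_ge (hlowr 0)
  refine le_antisymm ?_ ?_
  · refine le_of_forall_pos_le_add fun η hη ↦ ?_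
    obtain ⟨j, hj⟩ := exists_nat_one_div_lt hη
    exact (limsup_le_of_le hcobdd (hupr j)).trans (by linarith)
  · refine le_of_forall_pos_le_add fun η hη ↦ ?_
    obtain ⟨j, hj⟩ := exists_nat_one_div_lt hη
    have h1 : 1 / ((j : ℝ) + 2) ≤ 1 / ((j : ℝ) + 1) :=
      one_div_le_one_div_of_le (by positivity) (by linarith)
    have h2 := le_limsup_of_frequently_le (hlowr j) hbdd
    linarith

end Literature.Probability.Independence
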